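import Mathlib
import HarnessLib
import HarnessLib.Audit
import Summits.QuantumAdvantage.Statement
import Summits.QuantumAdvantage.AdviceFreeQNC0.AdviceFreeQNC0
import Summits.QuantumAdvantage.AdviceFreeQNC0.RingHardOdd
import Summits.QuantumAdvantage.AdviceFreeQNC0.AdviceFreeQNC0Three
import Summits.QuantumAdvantage.AdviceFreeQNC0.AffBells37PolyLoss
import Summits.QuantumAdvantage.AdviceFreeQNC0.BondTwistLocal
import Summits.QuantumAdvantage.QuantumAdvantage.Theorems.RingFrameBridge
import HarnessLib.Audit.Status.Attr

/-!
Route: SpreadDial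

# Route SpreadDial — Foreign-spread single-ring loss - a proved hybrid lemma turns ProductDial's
direct-product residual DPLift3 into a theorem plus one single-ring crux SpreadLoss3 (rung F-Q1-p3)

DECOMPOSITION CELL decomp-qadv (D-0178/D-0179), RESIDUAL MODE, node SpreadDial (lens
decomp-qadv-lens-5 g5 «finite/base range + asymptotic regime + bridge», NODE 2026-08-30T05:43:46Z,
file of record decomp-qadv-lens-5/SpreadDial.lean sha256
a60f627b05a9784eab5c18d50068efd9f87231c22520b0a894e580750d72d4de, 751 lines, lean check rc0 · 0
sorry · 0 warnings · axioms standard 31/31; critic decomp-qadv-crit-1 g2 row 28 CLEARED 05:45:35Z +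
28v2 05:51:09Z, refines-child of ProductDial:26124 DPLift3 and PencilDial:28431 GlobalPencilLift3).
RUNG CURRENCY ONLY — nothing here bears on the root `QuantumAdvantage`. T = RingHardOdd 3
(DWalkThree:22907 ≡ DegreeDial:24213), T* = ProductDial.MultiRingHard3
(stmt-QuantumAdvantage-26122). SHAPE B (sibling route; ProductDial is at its 15-item cap): it
suffices to show X = SpreadLoss3 =: T** (target r0, NEW, single-ring: some η > 0 and k such that at
every polylog degree every 𝔽₃ strategy keeps ≥ n^-k·2ⁿ losses INSIDE every «foreign win event» of
density ≥ 1-η cut out by ≤ n^k FIXED foreign patterns answered by polylog-degree outputs in the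
victim's input), filed as the declared pair PolyLoss3 (shared 26123, crux r2 = the budget-0 slice of
X, `polyLoss3_of_spreadLoss3` PROVED) ∧ CoverLift3 := PolyLoss3 → SpreadLoss3 (crux r3, DECLARED
RESIDUAL ≡ X mod 26123, `spreadLoss3_iff_polyLoss3_and_coverLift3` PROVED). THE DIRECT-PRODUCT
RESIDUAL BECOMES A THEOREM: SpreadBridge3 := SpreadLoss3 → MultiRingHard3 is PROVED in the node
(`multiRingHard3_of_spreadLoss3`, the HYBRID LEMMA `card_winAllSet_le_hybrid`: m = n^k rings
processed one at a time; on each fibre the processed rings' wins are a foreign win event for ring j,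
outputs stay lowDeg by tree `Smolensky.comp_subst_mem_lowDeg`; #A_(t+1) ≤ (1-d)#A_t + d(1-η)2^(mn);
(1-n^-k)^(n^k) ≤ 1/2) — no reduction, no answer verification, no majority. Necessity T ⟹ X PROVED
(`spreadLoss3_of_ringHardOdd`); the new residual DOMINATES both born residuals: CoverLift3 ⟹ DPLift3
(26124, `dpLift3_of_coverLift3`) and ⟹ GlobalPencilLift3 (28431, `globalPencilLift3_of_coverLift3`).
E_pres: every item is stated over tree constants and the writer junction file proves all ten
`Iff.rfl` against the node and against the tree items of ProductDial/PencilDial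
(sk/SpreadDialNodeJunction.lean rc0; negative control fails only at the planted line).
Lean: `∃ η : ℝ, 0 < η ∧ ∃ k : ℕ, ∀ c : ℕ, ∃ n₀ : ℕ, ∀ n ≥ n₀, ∀ P : Fin n →
Literature.Computability.MetaComplexity.Smolensky.CubeFn (ZMod 3) n, (∀ i, P i ∈
Literature.Computability.MetaComplexity.Smolensky.lowDeg (ZMod 3) n ((Nat.log 2 n) ^ c)) → ∀ m : ℕ,
m ≤ n ^ k → ∀ w : Fin m → Fin n → Bool, ∀ Q : Fin m → Fin n →
Literature.Computability.MetaComplexity.Smolensky.CubeFn (ZMod 3) n, (∀ t i, Q t i ∈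
Literature.Computability.MetaComplexity.Smolensky.lowDeg (ZMod 3) n ((Nat.log 2 n) ^ c)) → (1 - η) *
(2 : ℝ) ^ n ≤ ((Finset.univ.filter fun y : Fin n → Bool => ∀ t,
Literature.Computability.QuantumComplexity.RingHLF.Rel (w t) (fun i => decide (Q t i y = 1))).card :
ℝ) → 1 / (n : ℝ) ^ k * (2 : ℝ) ^ n ≤ ((Finset.univ.filter fun y : Fin n → Bool => (∀ t,
Literature.Computability.QuantumComplexity.RingHLF.Rel (w t) (fun i => decide (Q t i y = 1))) ∧ ¬
Literature.Computability.QuantumComplexity.RingHLF.Rel y (fun i => decide (P i y = 1))).card : ℝ)`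

## Assembly
Inside `closes` (glue.lean, one line, 0 sorry): `adviceFreeQNC0Three_iff.mpr
(Theorems.adviceFreeQNC0Sep_of_hlfNotFAC0Mod 3 (hB (hH (hC hP))))` — the residual CoverLift3 applied
to PolyLoss3 gives X = SpreadLoss3, the PROVED hybrid lemma SpreadBridge3 gives T* = MultiRingHard3,
ProductDial's PROVED bridge gives HLFNotFAC0Mod 3, and the landed
`Theorems.adviceFreeQNC0Sep_of_hlfNotFAC0Mod` with `adviceFreeQNC0Three_iff` concludes the leaf
F-Q1-p3. Binders consumed 4/4 (open cruxes PolyLoss3, CoverLift3; supports SpreadBridge3 PROVED in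
the node, MultiRingBridge3 PROVED in the ProductDial node) = the node's `closes₂` with the bridge
made an explicit binder. Writer files: sk/SpreadDialSketch.lean (items + closes, tree imports only,
rc0 · 0 sorry), sk/SpreadDialNodeJunction.lean (10/10 Iff.rfl vs node and vs tree
ProductDial/PencilDial items; `spreadBridge3_holds`, `spreadOrder3_holds`, closes via node closes₂
and via tree ProductDial.closes; rc0 · 0 sorry; negative control SpreadDialNodeJunctionNeg.lean
fails only at the planted line 822).

CLOSES_TARGET: closes rung F-Q1-p3 of QuantumAdvantage: Summit.QuantumAdvantage.AdviceFreeQNC0.AdviceFreeQNC0Three (D-0061; not the summit Statement) — the deciding theorem of this route concludes that registered leaf instead of the Statement decl `QuantumAdvantage` (class rung: servable and labelled, never counted as concluding the summit Statement).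

Rationale: WHY THIS LINE. The parent line PolyLoss3 (26123) —DPLift3 (26124, RESIDUAL)→ T* (26122) —26125→ leaf
had as its open residual a DIRECT-PRODUCT theorem for polylog-degree 𝔽₃ joint strategies against a
SEARCH relation, a class for which no direct-product / XOR lemma is in print (Viola–Wigderson
doi:10.4086/toc.2008.v004a007 stops at degree ≪ log n and at functions; black-box amplification
needs majority / answer verification, Grinberg–Shaltiel–Viola ECCC TR18-061 Thm 1.8, §5.3). The lens
files the dial on a NEW axis — the SIZE M of a foreign family a single ring must resist (`SpreadAt η
M k δ`): base M = 0 IS 26123 (`spreadAt_zero_iff` PROVED), first rung M = 1 (aside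
SpreadLossSingle3), asymptotic regime M = n^k = X — and PROVES the bridge X → T* by a reduction-free
hybrid over coordinates, the parallel-repetition shape (condition on the event that the processed
coordinates win) with the information-theoretic dense-conditioning lemma replaced by a
class-relative single-instance hypothesis and the weak→strong one-way-function budget t(n) = n·p(n)
(goldreich2004 Thm 2.3.2). Imported areas: hardness amplification / direct products
(doi:10.4086/toc.2008.v004a007, doi:10.1109/SFCS.1995.492584, goldreich2004), the polynomial method
over two moduli (Smolensky doi:10.1145/28395.28404; tree Smolensky.lowDeg restriction-closure), the
BGK ring game (arXiv:1704.00690 §4; arXiv:1906.08890; arXiv:2408.16406). What it does that prior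
routes do not: the multi-ring / joint-strategy quantifier is ELIMINATED from the open part of
F-Q1-p3's ProductDial and PencilDial lines (their residuals 26124 / 28431 are dominated by a
single-ring statement implied by T), and refuters get the strongest statement (T**, whose kill sinks
T: `not_ringHardOdd_of_not_spreadLoss3`). Negatives index: nothing refuted on this leaf concerns
conditional / multi-ring loss statements.

RANKED CRUXES. #0 SpreadLoss3 (target) — T** — FOREIGN-SPREAD LOSS (NEW, single ring; the node's
`SpreadLoss3`, TREE-READY inlined, junction Iff.rfl): some η > 0 and k such that for every degree
exponent c, all large n, every 𝔽₃ strategy P of degree ≤ (log₂ n)^c, every family of m ≤ n^k FIXED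
foreign patterns w_t answered by degree-≤(log₂ n)^c outputs Q_t in the victim's input y whose joint
win event E has density ≥ 1-η: at least n^-k·2ⁿ inputs y ∈ E lose the victim's ring game. NECESSARY
for T (PROVED `spreadLoss3_of_ringHardOdd`), SUFFICIENT for T* (PROVED hybrid lemma = item
SpreadBridge3), DOMINATES 26123 (budget-0 slice PROVED). WEAKER than T: UNDECIDED with test «spread
ratio» census n = 8–12 (instrument SR-1, census seat) and structural address (collapse = covering
problem (COV) across the MOD₂∘MOD₃ / MOD₃∘MOD₂ order swap of the S₃ ring monodromy; lens
SpreadDial-collapse-attempt.md 718c56bc…, critic 28v2). Leaf tags: IDEA-NEEDED beyond degree 1,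
INSTRUMENTABLE at M ≤ 1. [deps: PolyLoss3, CoverLift3] [difficulty: open-problem] (why it might
fail: a polylog-degree strategy whose 1/poly loss set is COVERABLE, up to n^-k·2ⁿ, by the complement
of one dense foreign win event (a sparse union of MOD₂-of-lowdeg-𝔽₃ co-events) — the covering
mechanism (COV); none known, no shelf result either way.) [arXiv:1704.00690,
doi:10.4086/toc.2008.v004a007, doi:10.1145/28395.28404, goldreich2004]
#2 PolyLoss3 (crux) — ProductDial's crux stmt-QuantumAdvantage-26123 (body VERBATIM, shared item;
staffed there and partitioned by FormsDichotomy 28147/28148): one k such that at every polylog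
degree every single-ring 𝔽₃ strategy wins the ring game on at most (1 − n^-k)·2ⁿ patterns. Here it
is the BASE M = 0 of the spread dial (`spreadAt_zero_iff`, PROVED) and the attacked conjunct of X;
first rung PROVED in the tree at degree 1 (affBellsPolyLoss3). ATTACKABLE. [difficulty:
open-problem] (why it might fail: a polylog-degree 𝔽₃ family winning the one-ring game with loss
n^-ω(1) (none known; every census family is few-forms and loses polynomially; FormsDichotomy splits
exactly this).) [arXiv:1704.00690, doi:10.1145/28395.28404, arXiv:2408.16406]
#3 CoverLift3 (crux) — DECLARED RESIDUAL (≡ SpreadLoss3 mod PolyLoss3,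
`spreadLoss3_iff_polyLoss3_and_coverLift3` PROVED): given 1/poly single-ring loss, the loss is
FOREIGN-SPREAD — PolyLoss3 → SpreadLoss3. NECESSARY for T (`coverLift3_of_ringHardOdd` PROVED);
DOMINATES both born residuals: → ProductDial.DPLift3 (26124, `dpLift3_of_coverLift3`) and →
PencilDial.GlobalPencilLift3 (28431, `globalPencilLift3_of_coverLift3`), so it is AT MOST AS STRONG
as either residual it replaces while their multi-ring content is discharged by the proved hybrid
lemma. WHY EASIER (named structure): one ring, one low-degree map, events definable by OTHER
low-degree maps through a fixed long kernel parity — the home of restriction / polynomial-method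
arguments (Smolensky.lowDeg closed under the substitutions used). WEAKER than 26124: UNDECIDED (no
converse DPLift3 → CoverLift3: fixed vs random foreign patterns). Leaf tag: IDEA-NEEDED
(single-ring); first rung = aside SpreadLossSingle3 (M = 1). [deps: PolyLoss3] [difficulty:
open-problem] (why it might fail: exactly where SpreadLoss3 fails beyond PolyLoss3: a near-optimal
strategy could concentrate its n^-k losses on the co-event of one dense MOD₂∘lowdeg-𝔽₃ foreign event
(TwoModuliDepthTwo technique vacuum: no tool bounds such coverings either way).)
[doi:10.4086/toc.2008.v004a007, doi:10.1145/28395.28404, arXiv:1704.00690]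
#9 SpreadBridge3 (support) — THE HYBRID LEMMA (PROVED in the node: `multiRingHard3_of_spreadLoss3`
via `card_winAllSet_le_hybrid`, `fibre_decrement`, `sum_card_filter_update`, `decay_le_half`, tree
`Smolensky.comp_subst_mem_lowDeg`; K := k, θ := 1 − min η 1 / 2; axioms standard): SpreadLoss3 →
MultiRingHard3. Load-bearing binder of `closes`; LAND FIRST (one Theorems file porting node lines
430–712; writer junction `spreadBridge3_holds`). [difficulty: provable-now] [goldreich2004,
doi:10.4086/toc.2008.v004a007, arXiv:1704.00690]
#9 MultiRingBridge3 (support) — ProductDial's bridge stmt-QuantumAdvantage-26125 (body VERBATIM,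
shared, PROVED in the ProductDial node): MultiRingHard3 → HLFNotFAC0Mod 3 (solve ⇒ win-all grid
embedding). Load-bearing binder of `closes`. [difficulty: S] [arXiv:1704.00690,
doi:10.1145/28395.28404]
#9 MultiRingHard3 (support) — ProductDial's target T* stmt-QuantumAdvantage-26122 (body VERBATIM,
shared record; needed BY NAME by SpreadBridge3 / DPLift3 / MultiRingBridge3): some K and θ < 1 such
that at every polylog degree every joint 𝔽₃ strategy for n^K rings wins all rings on at most
θ·2^(n^K·n) input tuples. [difficulty: open-problem] [arXiv:1704.00690,
doi:10.4086/toc.2008.v004a007]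
#9 SpreadLossSingle3 (support) — aside — FIRST NEW RUNG M = 1 of the spread dial (node
`SpreadLossSingle3`, TREE-READY, `spreadLossSingle3_of_spreadLoss3` PROVED): the victim keeps ≥
n^-k·2ⁿ losses inside every SINGLE dense foreign win event. INSTRUMENTABLE (census SR-1 «spread
ratio», n = 8–12: min over affine single foreign events E with |E| ≥ (1-η)2ⁿ, η ∈ {1/8, 1/4}, of |E
∩ Loss(P)|/|Loss(P)| for the near-optimal affine/quadratic strategies of the M2/row-14R censuses)
and the BC5 plan-only first prover target (victim and foreign outputs of degree ≤ 1 via the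
AffBells37 slice-expansion fibre method run inside one kernel-parity event). Record of the dial, not
a binder. [difficulty: L] [arXiv:1704.00690, doi:10.1145/28395.28404]
#9 DPLift3 (support) — aside — ProductDial's declared residual stmt-QuantumAdvantage-26124 (body
VERBATIM, shared record): PolyLoss3 → MultiRingHard3. ORDER RECORD: DOMINATED by CoverLift3
(`dpLift3_of_coverLift3` = CoverLift3 ∘ SpreadBridge3, currying) and it dominates
PencilDial.GlobalPencilLift3 (28431) by currying (`fun hD hP _ => hD hP`) — provers attack the
WEAKEST open residual (GlobalPencilLift3 ⟸ DPLift3 ⟸ CoverLift3) knowingly, refuters the STRONGEST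
statement (SpreadLoss3, whose kill sinks T). [difficulty: open-problem]
[doi:10.4086/toc.2008.v004a007, arXiv:1704.00690]
#9 SpreadOrder3 (support) — aside — ORDER RECORDS of the node, all PROVED there (writer junction
`spreadOrder3_holds` := ⟨dpLift3_of_coverLift3, polyLoss3_of_spreadLoss3,
spreadLossSingle3_of_spreadLoss3, spreadLoss3_of_ringHardOdd⟩; closable by one port): (CoverLift3 →
DPLift3) ∧ (SpreadLoss3 → PolyLoss3) ∧ (SpreadLoss3 → SpreadLossSingle3) ∧ (RingHardOdd 3 →
SpreadLoss3). Kill lane: ¬SpreadLoss3 ⇒ ¬RingHardOdd 3 (closes DWalkThree:22907 / DegreeDial:24213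
negatively). [difficulty: provable-now] [arXiv:1704.00690, goldreich2004]

TWO-LAYER PLAN. CoverLift3 ⇐ stub_coverSingle3 (PolyLoss3 → SpreadLossSingle3: the first foreign
event, M = 1 — ATTACKABLE at victim/foreign degree ≤ 1 by the AffBells37 fibre method;
INSTRUMENTABLE by SR-1) ∧ stub_singleToPoly3 (SpreadLossSingle3 → SpreadLoss3: the budget lift 1 →
n^k — IDEA-NEEDED; intersections of m foreign events are one foreign event of a LONGER family, so
the content is uniformity of (η, k) in m) — BC3 skeleton bc-sd/CoverLift3_birth.lean (CoverLift3_of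
proved from the two stubs). PolyLoss3's layer 2 is FormsDichotomy (28147 FewFormsPolyLoss3 ∧ 28148
FarFewFormsPolyLoss3, glue 28149 PROVED) — not re-filed here.

KILL CRITERIA. A polylog-degree single-ring family P together with ≤ n^k fixed foreign
patterns/outputs whose dense win event swallows all but n^-k·2ⁿ·o(1) of P's losses, for every (η,
k), refutes SpreadLoss3 — close --reason refuted:SpreadLoss3 — AND refutes T = RingHardOdd 3
(`not_ringHardOdd_of_not_spreadLoss3`), flagging DWalkThree:22907 / DegreeDial:24213; a refutation
of CoverLift3 alone (given 26123) has the same effect. A refutation of PolyLoss3 (26123) kills this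
route with ProductDial/PencilDial/FormsDichotomy. Proved elsewhere: RingHardOdd 3 (T) moots the
route (T ⟹ every item); DPLift3 (26124) proved directly moots CoverLift3's role but not X.

NOT DECOMPOSED YET. CoverLift3 stays whole at open (declared residual; its M = 1 rung is an aside
and its two regimes are a skeleton, not children). The degree dial of SpreadLoss3 (victim degree 1,
2, …) is not filed — the degree-1 spread rung is the BC5 plan-only stub. No item for the currying
facts DPLift3 → GlobalPencilLift3 and CoverLift3 ∘ SpreadBridge3 = DPLift3 (crux.provable-cheap;
docstring facts only).

CHEAPEST FALSIFIER. Census SR-1 «spread ratio» (kit minutes, census seat; kit not allowed on this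
seat): for n = 8…12, the near-optimal affine / quadratic single-ring strategies P of the M2 /
row-14R censuses and every SINGLE affine foreign event E = {y | ⊕_(i∈supp v(w)) [Q_i(y)=1] = b} with
|E| ≥ (1-η)2ⁿ, η ∈ {1/8, 1/4}: report min_E |E ∩ Loss(P)| / |Loss(P)|. A ratio → 0 along a family
exhibits the covering mechanism (COV) a refutation of SpreadLossSingle3 ⊂ SpreadLoss3 needs; bounded
away from 0 uniformly in n supports the item. Not run by the writer.

NUMBERS. Bridge constants (PROVED): K := k (rings exponent = loss exponent, m·d = 1), θ := 1 − min η
1 / 2, via #winAll ≤ ((1-η) + η(1-d)^m)·2^(mn) and (1 − n^-k)^(n^k) ≤ e^-1 ≤ 1/2 (`decay_le_half`).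
Base: M = 0 ≡ 26123 (`spreadAt_zero_iff`). Degree-1 base rung in the tree: affBellsPolyLoss3 (loss ≥
N^-5 of the odd class, n₀ = 200). Monotonicity PROVED: `spreadAt_mono_eta`, `spreadAt_mono_budget`,
`spreadAt_anti_deg`.

DEFINITION REQUESTS. None: every item is stated in EVALUATED form over tree constants
(`Smolensky.CubeFn/lowDeg`, `RingHLF.Rel`, `finProdFinEquiv`, Finset cards); the node's bookkeeping
defs (winSet/LossAt/SpreadAt/flat/winAllSet/MultiHardAt) are eliminated by Iff.rfl (writer junction
file).

Novelty: Searches (lens g5 + writer, 2026-08-30): tree `rg 'direct product|XOR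
lemma|JointStrategy|hybrid|SpreadAt' Summits/QuantumAdvantage Literature` (hits: ProductDial
MultiRingHard3/DPLift3/dpTriangular3, PencilDial; no conditional-loss / foreign-event statement);
`lit galaxy search "direct product theorem|uniform direct product|XOR lemma for polynomials" --star
all` (20 rows, none relevant); `lit galaxy search "strong direct product|parallel repetition
theorem|hard-core set lemma" --star pdf` (10 rows: [galaxy:pdf:1422768814205165220] Gröpl–Skutella
exposition of Raz's parallel repetition; [galaxy:pdf:-1327026717923147780] Grinberg–Shaltiel–Viola
ECCC TR18-061); `lit search --hybrid "direct product theorem hybrid argument dense event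
conditioning"` (8 docs; [corpus:goldreich2004-foundations-cryptography p.64–65 Thm 2.3.2]
weak→strong OWF hybrid); `lit vsearch` of the hybrid statement in prose (8 docs; only
[corpus:goldreich2004-foundations-cryptography p.324]); [corpus:paper:doi-10-1109-ccc-2007-15 p.1]
Viola–Wigderson (XOR of m copies of GF(2) polynomials, degree ≪ log n). No hits for a
class-relativised single-instance hypothesis of the SpreadAt shape in corpus (fts+vec) and galaxy.
Nearest prior art found: in tree, ProductDial:26124 (the dominated residual) and gen-2's PROVED
triangular direct product `dpTriangular3` (= the budget-0 point of the hybrid run in the opposite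
order); PencilDial:28431 (class restriction, different axis); in print, Raz-style parallel
repetition (co  [refs: 10.4086/toc.2008.v004a007, paper:doi-10-1109-ccc-2007-15, doi:10.4086/toc.2008.v004a007]

Barriers (technique_class: polynomial-method, direct-product, two-moduli, hybrid): - technique_class: polynomial-method, direct-product, two-moduli, hybrid
- Literature.Barriers.QuantumAdvantage.TwoModuliDepthTwo: ADJACENT, not inside — the foreign
co-events ARE depth-two two-moduli conditions (MOD₂ of polylog-degree 𝔽₃ bits); the barrier records
a technique vacuum for lower bounds against such expressions and does not quantify over the ring
relation; SpreadLoss3 / CoverLift3 ask for loss INSIDE such events, so a proof must say something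
about them — the honest locus of difficulty (the bet: the events enter only through their DENSITY ≥
1-η and a long parity over a kernel support, not their fine structure); the PROVED bridge uses them
only through restriction-closure.
- Literature.Barriers.QuantumAdvantage.NonclassicalDegreeLogBarrier: the print direct-product / XOR
technology for polynomials (Gowers norms, Viola–Wigderson) stops at degree log n; the hybrid lemma
is degree-agnostic (any D), so the bridge is OUTSIDE that class; the cruxes inherit the barrier
exactly as T and 26123 do (polylog degree), no better, no worse.
- Literature.Barriers.QuantumAdvantage.TotalFunctionSpeedupLimit: not in play — the ring game is a
RELATION with many correct outputs under an average-case measure over patterns (evasions 2–5 of the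
audited entry); no query-complexity step.
- Literature.Barriers.QuantumAdvantage.NaturalProofs: not in play — explicit polylog-degree 𝔽₃
polynomial maps vs an explicit relation; no P/poly largeness/constructivity argument.
- Literature.Barriers.Q

History (route lifecycle, newest last):
- 2026-08-30T08:20:00Z · rev 2: informal re-worded for CoverLift3 (planner-decomp-qadv-writer-1-g4-0)
- 2026-08-30T12:47:53Z · rev 3: informal re-worded for PureCover3, CoverLift3 (planner-decomp-qadv-writer-1-g5-0)
- 2026-08-30T13:42:24Z · rev 4: informal re-worded for AlgCover3 (planner-decomp-qadv-writer-1-g5-0)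
- 2026-08-30T14:04:49Z · rev 5: informal re-worded for AlgCover3 (planner-decomp-qadv-writer-1-g5-0)
- 2026-08-30T14:17:30Z · rev 6: informal re-worded for AlgCover3 (planner-decomp-qadv-writer-1-g5-0)
- 2026-08-30T17:14:56Z · rev 7: informal re-worded for PureCover3 (planner-decomp-qadv-writer-1-g5-0)

sub-problem: QuantumAdvantage · status: draft · opened planner-decomp-qadv-writer-1-g3-0 2026-08-30T06:08:10Z · rev 7 · ledger route-QuantumAdvantage-SpreadDial
GENERATED by the gate from the ledger (D-0016/17). Provers cite these decls: `theorem foo : Summit.QuantumAdvantage.QuantumAdvantage.Theses.SpreadDial.<Decl> := …` in Summits/QuantumAdvantage/QuantumAdvantage/Theorems/<Name>.lean.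
-/

namespace Summit.QuantumAdvantage.QuantumAdvantage.Theses.SpreadDial

open scoped BigOperators Topology Manifold Classical MeasureTheory ProbabilityTheory Matrix InnerProductSpace ComplexConjugate ContinuousMap
open Filter Set Function TopologicalSpace MeasureTheory

attribute [summit_statement] _root_.QuantumAdvantage
attribute [summit_statement] _root_.Summit.QuantumAdvantage.AdviceFreeQNC0.AdviceFreeQNC0Three

open Literature.QuantumAdvantage

/-- item stmt-QuantumAdvantage-29064 · target · rank 0 · open · by planner
why it might fail: a polylog-degree strategy whose 1/poly loss set is COVERABLE, up to n^-k·2ⁿ, by the complement of one dense foreign win event (a sparse union of MOD₂-of-lowdeg-𝔽₃ co-events) — the covering mechanism (COV); none known, no shelf result either way.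
sources: arXiv:1704.00690, doi:10.4086/toc.2008.v004a007, doi:10.1145/28395.28404, goldreich2004
[target] T** — FOREIGN-SPREAD LOSS (NEW, single ring; the node's `SpreadLoss3`, TREE-READY inlined,
junction Iff.rfl): some η > 0 and k such that for every degree exponent c, all large n, every 𝔽₃
strategy P of degree ≤ (log₂ n)^c, every family of m ≤ n^k FIXED foreign patterns w_t answered by
degree-≤(log₂ n)^c outputs Q_t in the victim's input y whose joint win event E has density ≥ 1-η: at
least n^-k·2ⁿ inputs y ∈ E lose the victim's ring game. NECESSARY for T (PROVED
`spreadLoss3_of_ringHardOdd`), SUFFICIENT for T* (PROVED hybrid lemma = item SpreadBridge3),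
DOMINATES 26123 (budget-0 slice PROVED). WEAKER than T: UNDECIDED with test «spread ratio» census n
= 8–12 (instrument SR-1, census seat) and structural address (collapse = covering problem (COV)
across the MOD₂∘MOD₃ / MOD₃∘MOD₂ order swap of the S₃ ring monodromy; lens
SpreadDial-collapse-attempt.md 718c56bc…, critic 28v2). Leaf tags: IDEA-NEEDED beyond degree 1,
INSTRUMENTABLE at M ≤ 1. [deps: PolyLoss3, CoverLift3] [difficulty: open-problem] -/
@[route_item "route-QuantumAdvantage-SpreadDial", crux]
def SpreadLoss3 : Prop :=
  ∃ η : ℝ, 0 < η ∧ ∃ k : ℕ, ∀ c : ℕ, ∃ n₀ : ℕ, ∀ n ≥ n₀, ∀ P : Fin n → Literature.Computability.MetaComplexity.Smolensky.CubeFn (ZMod 3) n, (∀ i, P i ∈ Literature.Computability.MetaComplexity.Smolensky.lowDeg (ZMod 3) n ((Nat.log 2 n) ^ c)) → ∀ m : ℕ, m ≤ n ^ k → ∀ w : Fin m → Fin n → Bool, ∀ Q : Fin m → Fin n → Literature.Computability.MetaComplexity.Smolensky.CubeFn (ZMod 3) n, (∀ t i, Q t i ∈ Literature.Computability.MetaComplexity.Smolensky.lowDeg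 (ZMod 3) n ((Nat.log 2 n) ^ c)) → (1 - η) * (2 : ℝ) ^ n ≤ ((Finset.univ.filter fun y : Fin n → Bool => ∀ t, Literature.Computability.QuantumComplexity.RingHLF.Rel (w t) (fun i => decide (Q t i y = 1))).card : ℝ) → 1 / (n : ℝ) ^ k * (2 : ℝ) ^ n ≤ ((Finset.univ.filter fun y : Fin n → Bool => (∀ t, Literature.Computability.QuantumComplexity.RingHLF.Rel (w t) (fun i => decide (Q t i y = 1))) ∧ ¬ Literature.Computability.QuantumComplexity.RingHLF.Rel y (fun i => decide (P i y = 1))).card : ℝ)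

/-- item stmt-QuantumAdvantage-26123 · crux · rank 2 · open · by planner
why it might fail: a polylog-degree 𝔽₃ family winning the one-ring game with loss n^-ω(1) (none known; every census family is few-forms and loses polynomially; FormsDichotomy splits exactly this).
sources: arXiv:1704.00690, doi:10.1145/28395.28404, arXiv:2408.16406
[crux] inverse-polynomial single-ring loss at every polylog degree: some k such that for every c,
for all large n, every single-ring 𝔽₃-strategy (z_i = [P_i(x) = 1], deg P_i ≤ (log₂ n)^c) satisfies
the n-cycle relation RingHLF.Rel on at most (1 − n^(−k))·2^n of ALL 2^n inputs (plain count).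
Strictly weaker than T (T ⇒ PolyLoss3, `polyLoss3_of_ringHardOdd`) and than AffineCore3's
constant-loss demand; degree-1 slice PROVED (`polyLossOne3`, from the tree's
AffBells37.affBellsPolyLoss3). [difficulty: L] -/
@[route_item "route-QuantumAdvantage-SpreadDial", crux]
def PolyLoss3 : Prop :=
  ∃ k : ℕ, ∀ c : ℕ, ∃ n₀ : ℕ, ∀ n ≥ n₀, ∀ P : Fin n → Literature.Computability.MetaComplexity.Smolensky.CubeFn (ZMod 3) n, (∀ i, P i ∈ Literature.Computability.MetaComplexity.Smolensky.lowDeg (ZMod 3) n ((Nat.log 2 n) ^ c)) → ((Finset.univ.filter fun x : Fin n → Bool => Literature.Computability.QuantumComplexity.RingHLF.Rel x (fun i => decide (P i x = 1))).card : ℝ) ≤ (1 - 1 / (n : ℝ) ^ k) * (2 : ℝ) ^ n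

/-- item stmt-QuantumAdvantage-29065 · crux · rank 3 · SPLIT (gen 1) into AlgCover3, PureCover3 + glue CoverSplitGlue3 · direct attempts still welcome (low priority) · by planner
why it might fail: exactly where SpreadLoss3 fails beyond PolyLoss3: a near-optimal strategy could concentrate its n^-k losses on the co-event of one dense MOD₂∘lowdeg-𝔽₃ foreign event (TwoModuliDepthTwo technique vacuum: no tool bounds such coverings either way).
sources: doi:10.4086/toc.2008.v004a007, doi:10.1145/28395.28404, arXiv:1704.00690
[crux] DECLARED RESIDUAL (≡ SpreadLoss3 mod PolyLoss3, `spreadLoss3_iff_polyLoss3_and_coverLift3`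
PROVED): given 1/poly single-ring loss, the loss is FOREIGN-SPREAD — PolyLoss3 → SpreadLoss3.
NECESSARY for T (`coverLift3_of_ringHardOdd` PROVED); DOMINATES both born residuals: →
ProductDial.DPLift3 (26124, `dpLift3_of_coverLift3`) and → PencilDial.GlobalPencilLift3 (28431,
`globalPencilLift3_of_coverLift3`), so it is AT MOST AS STRONG as either residual it replaces while
their multi-ring content is discharged by the proved hybrid lemma. WHY EASIER (named structure): one
ring, one low-degree map, events definable by OTHER low-degree maps through a fixed long kernel
parity — the home of restriction / polynomial-method arguments (Smolensky.lowDeg closed under the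
substitutions used). WEAKER than 26124: UNDECIDED (no converse DPLift3 → CoverLift3: fixed vs random
foreign patterns). Leaf tag: IDEA-NEEDED (single-ring); first rung = aside SpreadLossSingle3 (M =
1). [deps: PolyLoss3] [difficulty: open-problem] SPLIT RECORD 2026-08-30 (lens-5 g7 SteerDial node
sha256 8db77bdf267c7437…, critic row 40 CLEARED 2026-08-30T07:58:28Z (SPLIT node, class modest-plus;
farm rc0 · 0 sorry; bc2 14/14 m -/
@[route_item "route-QuantumAdvantage-SpreadDial", crux]
def CoverLift3 : Prop :=
  PolyLoss3 → SpreadLoss3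

-- parent: CoverLift3 · child (gen 1)
/--     item stmt-QuantumAdvantage-30909 · crux · rank 301 · open
    parent: CoverLift3 · by planner
    why it might fail: PolyLoss3 gives 1/poly loss but not WHERE: a dense algebraic test may omit an η ≫ 1/poly fraction carrying all losses; proved only for level classes and identity-word cylinders.
    sources: arXiv:1704.00690, doi:10.1145/28395.28404, doi:10.1109/SFCS.1995.492584, arXiv:2408.16406
[crux · W-piece of the split 29065 CoverLift3 ⟺ AlgCover3 ∧ PureCover3 (coverLift3_iff PROVED in
node) · ≡ AlgSpread3 mod 26123 · WEAKER than 29065 by form (algCover3_of_coverLift3 PROVED) ·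
STRICT: UNDECIDED (converse = PureCover3) · ONE MODULUS ⇒ outside TwoModuliDepthTwo · OPEN ·
INSTRUMENTABLE (ALG-SPREAD-1) · PARTIAL RANGE PROVED: PolyLoss3 ⇒ 1/poly loss inside EVERY single
Hamming level class {|x| ≡ t mod 3} (levelSpread3_of_polyLoss3, aside LevelCover3 = BC5 witness) and
inside every certified identity-word cylinder (windowLoss3_of_polyLoss3) by the identity-word FOLD
LAW rel_fold (MBQC wire identities with Pauli-byproduct sign flips as a degree-preserving classical
STEERING law; decide'd certificates W0/W1/W2)] poly-loss hardness of ONE ring survives conditioning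
on any dense low-degree 𝔽₃ event. critic row 40 CLEARED 2026-08-30T07:58:28Z (SPLIT node, class
modest-plus; farm rc0 · 0 sorry; bc2 14/14 must-fail FAIL; bc7 4/4 CLEAN; axioms std).
STEER/INERTNESS RECORD (2026-08-30; lens-5 g9 «TagDial» 9af4092b/ed25ceb3 + critic row 60 —
mechanics VERIFIED, hinge OBJECTED): PROVED (kernel, std axioms; tree twins SteerDialRotList
44e03cc7 LAND-READY --supports 30909): ADAPTIVE ST -/
@[route_item "route-QuantumAdvantage-SpreadDial", crux]
def AlgCover3 : Prop :=
  PolyLoss3 → ∃ η : ℝ, 0 < η ∧ ∃ k : ℕ, ∀ c : ℕ, ∃ n₀ : ℕ, ∀ n ≥ n₀, ∀ P : Fin n → Literature.Computability.MetaComplexity.Smolensky.CubeFn (ZMod 3) n, (∀ i, P i ∈ Literature.Computability.MetaComplexity.Smolensky.lowDeg (ZMod 3) n ((Nat.log 2 n) ^ c)) → ∀ ψ : Literature.Computability.MetaComplexity.Smolensky.CubeFn (ZMod 3) n, ψ ∈ Literature.Computability.MetaComplexity.Smolensky.lowDeg (ZMod 3) n ((Nat.log 2 n) ^ c) → (1 -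 η) * (2 : ℝ) ^ n ≤ ((Finset.univ.filter fun y : Fin n → Bool => ψ y = 1).card : ℝ) → 1 / (n : ℝ) ^ k * (2 : ℝ) ^ n ≤ ((Finset.univ.filter fun y : Fin n → Bool => ψ y = 1 ∧ ¬ Literature.Computability.QuantumComplexity.RingHLF.Rel y (fun i => decide (P i y = 1))).card : ℝ)

-- parent: CoverLift3 · child (gen 1)
/--     item stmt-QuantumAdvantage-30910 · crux · rank 302 · open
    parent: CoverLift3 · by planner
    why it might fail: foreign-win events are two-moduli depth-two sets (MOD-2 of 𝔽₃ bits on supports ≥ n/2), not inner-approximable by dense polylog 𝔽₃ sets in general (TwoModuliDepthTwo); algebraic spread may not transfer.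
    sources: arXiv:1704.00690, doi:10.1145/28395.28404, doi:10.1109/SFCS.1995.492584, arXiv:2408.16406
[crux · DECLARED RESIDUAL of the SpreadDial line after the split (replaces 29065 as the planless
piece; 29065 = AlgCover3 ∧ PureCover3) · weaker than 29065 by form (pureCover3_of_coverLift3 PROVED)
· STRICT: UNDECIDED · BARRIER Literature.Barriers.QuantumAdvantage.TwoModuliDepthTwo (algebraic →
relational tests: membership in a foreign-win event is a conjunction of MOD-2 conditions on
polylog-degree 𝔽₃ bits) · IDEA-NEEDED] granted algebraic spread, pass from one-modulus algebraic
tests to the ≤ n^k two-moduli foreign-win tests of SpreadLoss3. critic row 40 CLEARED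
2026-08-30T07:58:28Z (SPLIT node, class modest-plus; farm rc0 · 0 sorry; bc2 14/14 must-fail FAIL;
bc7 4/4 CLEAN; axioms std). TAME RECORD = LOCATED CORE (2026-08-30; lens-5 g8 «TameDial» node
fd9002fb, 2483 l, farm rc0 · 0 sorry · axioms std · bc2 21/21 must-fail FAIL · bc7 6/6 CLEAN; critic
row 55 VERIFIED MEDIUM-HIGH; NO split of this item — every new piece is ≡ it modulo constants
(location, not shrink, declared honestly); SpreadDial at cap): TAMENESS DIAL r = number of ROUGH
foreign rings (a ring is (D,L)-tame iff its fibre win event has an algebraic inner core of degree ≤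
D missing ≤ L points). PROVED: tame rings ar -/
@[route_item "route-QuantumAdvantage-SpreadDial"]
def PureCover3 : Prop :=
  PolyLoss3 → (∃ η : ℝ, 0 < η ∧ ∃ k : ℕ, ∀ c : ℕ, ∃ n₀ : ℕ, ∀ n ≥ n₀, ∀ P : Fin n → Literature.Computability.MetaComplexity.Smolensky.CubeFn (ZMod 3) n, (∀ i, P i ∈ Literature.Computability.MetaComplexity.Smolensky.lowDeg (ZMod 3) n ((Nat.log 2 n) ^ c)) → ∀ ψ : Literature.Computability.MetaComplexity.Smolensky.CubeFn (ZMod 3) n, ψ ∈ Literature.Computability.MetaComplexity.Smolensky.lowDeg (ZMod 3) n ((Nat.log 2 n) ^ c) → (1 - η) * (2 : ℝ) ^ n ≤ ((Finset.univ.filter fun y : Fin n → Bool => ψ y = 1).card : ℝ) → 1 / (n : ℝ) ^ k * (2 : ℝ) ^ n ≤ ((Finset.univ.filter fun y : Fin n → Bool => ψ y = 1 ∧ ¬ Literature.Computability.QuantumComplexity.RingHLF.Rel y (fun i => decide (P i y = 1))).card : ℝ)) → SpreadLoss3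

-- parent: CoverLift3 · glue (gen 1)
/--     item stmt-QuantumAdvantage-30911 · support · rank 303 · closed · proved by Summit.QuantumAdvantage.QuantumAdvantage.Theorems.SteerDial.coverSplitGlue3 (prover)
    parent: CoverLift3 · GLUE: children ⟹ parent · by planner
AlgCover3 → PureCover3 → CoverLift3: the exact split of the residual (coverLift3_iff PROVED in the
lens-5 g7 SteerDial node; one line fun hA hR hP => hR hP (hA hP)) -/
@[route_item "route-QuantumAdvantage-SpreadDial"]
def CoverSplitGlue3 : Prop :=
  AlgCover3 → PureCover3 → CoverLift3

-- `CoverSplitGlue3` holds: proved by `Summit.QuantumAdvantage.QuantumAdvantage.Theorems.SteerDial.coverSplitGlue3` (its module imports this route file, so no `_holds` link can be stated here).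

/-- item stmt-QuantumAdvantage-26122 · support · rank 9 · open · by planner
sources: arXiv:1704.00690, doi:10.4086/toc.2008.v004a007
[target] T* (the reformulated target, rank 0; assembly conclusion of layer 2): there are K and θ < 1
such that for every c, for all large n, every joint strategy for n^K rings of length n whose outputs
are 𝔽₃-polynomials of degree ≤ (log₂ n)^c in all n^K·n input bits wins all rings (each ring's output
satisfies RingHLF.Rel) on at most θ·2^(n^K·n) input tuples. T → T* proved (node file
`multiRingHard3_of_ringHardOdd`); T* → PolyLoss3 proved (`polyLoss3_of_multiRingHard3`). [deps:
PolyLoss3, DPLift3] [difficulty: open-problem] -/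
@[route_item "route-QuantumAdvantage-SpreadDial"]
def MultiRingHard3 : Prop :=
  ∃ K : ℕ, ∃ θ : ℝ, θ < 1 ∧ ∀ c : ℕ, ∃ n₀ : ℕ, ∀ n ≥ n₀, ∀ P : Fin (n ^ K) → Fin n → Literature.Computability.MetaComplexity.Smolensky.CubeFn (ZMod 3) (n ^ K * n), (∀ j i, P j i ∈ Literature.Computability.MetaComplexity.Smolensky.lowDeg (ZMod 3) (n ^ K * n) ((Nat.log 2 n) ^ c)) → ((Finset.univ.filter fun X : Fin (n ^ K) → Fin n → Bool => ∀ j, Literature.Computability.QuantumComplexity.RingHLF.Rel (X j) (fun i => decide (P j i (fun k => X (finProdFinEquiv.symm k).1 (finProdFinEquiv.symm k).2) = 1))).card : ℝ) ≤ θ * (2 : ℝ) ^ (n ^ K * n)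

/-- item stmt-QuantumAdvantage-26124 · aside · rank 9 · open · by planner
sources: doi:10.4086/toc.2008.v004a007, arXiv:1704.00690
[crux] DECLARED-RESIDUAL (NO-SHRINK piece, critic row 9): the direct-product lift PolyLoss3 →
MultiRingHard3 — an inverse-polynomial loss per ring at every polylog degree amplifies, over n^K
disjoint rings read JOINTLY, to a constant all-rings bound. Proved special cases in the node file:
separable strategies (`dpSeparable3`) and triangular/causal reading orders (`dpTriangular3`,
induction over rings via `card_winAllSet_triangular_le`); the symmetric cross-reading case is the
open content; constant-degree sub-rung DPLiftConst3 filed as aside. [deps: PolyLoss3] [difficulty: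
open-problem] -/
@[route_item "route-QuantumAdvantage-SpreadDial"]
def DPLift3 : Prop :=
  PolyLoss3 → MultiRingHard3

/-- item stmt-QuantumAdvantage-26125 · support · rank 9 · closed · proved by Summit.QuantumAdvantage.QuantumAdvantage.Theorems.pencilDial_multiRingBridge3 (prover) · by planner
sources: arXiv:1704.00690, doi:10.1145/28395.28404
[support] LOAD-BEARING support (binder of `closes`; critic: staff/land FIRST): T* feeds the
registered leaf hypothesis — MultiRingHard3 → HLFNotFAC0Mod 3: restrict N×N 2D-HLF circuits over
accBasis 3 to instances carrying n^K disjoint square cycles of length n, turn the FAC⁰[3] circuit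
tuple into ONE joint polylog-degree 𝔽₃-strategy for all rings at once by the relational
Razborov–Smolensky lemma (tree `Smolensky.exists_uniformProb_le`, error counted once for the whole
tuple), transfer HLF solutions to ring wins ring by ring (tree `GridCycle.rel_of_mem_hlfSolutions`),
exactly as the single-ring bridge `Theorems.hlfNotFAC0Mod_of_ringHard8` (RingFrameBridge.lean:119)
with the packing of n^K cycles replacing one 8t-cycle. [difficulty: M] STATUS 2026-08-30 (record
correction): PROVED in a LAND-READY file — BridgeDial (lens-5 g6) Theorems/MultiRingBridge.lean
sha256 d782ca8a… (832 l, farm rc0 · 0 sorry): `Theorems.productDial_multiRingBridge3 :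
ProductDial.MultiRingBridge3` (this shared decl — closes the item in all six routes) and
`adviceFreeQNC0Three_of_multiRingHard3 : MultiRingHard3 → AdviceFreeQNC0Three`; attached as evidence
on this item; LAND FIRST `ledger propose --kind proof -- -/
@[route_item "route-QuantumAdvantage-SpreadDial", crux]
def MultiRingBridge3 : Prop :=
  MultiRingHard3 → Summit.QuantumAdvantage.AdviceFreeQNC0.HLFNotFAC0Mod 3

-- `MultiRingBridge3` holds: proved by `Summit.QuantumAdvantage.QuantumAdvantage.Theorems.pencilDial_multiRingBridge3` (its module imports this route file, so no `_holds` link can be stated here).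

/-- item stmt-QuantumAdvantage-29066 · support · rank 9 · closed · proved by Summit.QuantumAdvantage.QuantumAdvantage.Theorems.spreadDial_spreadBridge3 (prover) · by planner
sources: goldreich2004, doi:10.4086/toc.2008.v004a007, arXiv:1704.00690
[support] THE HYBRID LEMMA (PROVED in the node: `multiRingHard3_of_spreadLoss3` via
`card_winAllSet_le_hybrid`, `fibre_decrement`, `sum_card_filter_update`, `decay_le_half`, tree
`Smolensky.comp_subst_mem_lowDeg`; K := k, θ := 1 − min η 1 / 2; axioms standard): SpreadLoss3 →
MultiRingHard3. Load-bearing binder of `closes`; LAND FIRST (one Theorems file porting node lines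
430–712; writer junction `spreadBridge3_holds`). [difficulty: provable-now] -/
@[route_item "route-QuantumAdvantage-SpreadDial", crux]
def SpreadBridge3 : Prop :=
  SpreadLoss3 → MultiRingHard3

-- `SpreadBridge3` holds: proved by `Summit.QuantumAdvantage.QuantumAdvantage.Theorems.spreadDial_spreadBridge3` (its module imports this route file, so no `_holds` link can be stated here).

/-- item stmt-QuantumAdvantage-29067 · aside · rank 9 · open · by planner
sources: arXiv:1704.00690, doi:10.1145/28395.28404
[support] aside — FIRST NEW RUNG M = 1 of the spread dial (node `SpreadLossSingle3`, TREE-READY,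
`spreadLossSingle3_of_spreadLoss3` PROVED): the victim keeps ≥ n^-k·2ⁿ losses inside every SINGLE
dense foreign win event. INSTRUMENTABLE (census SR-1 «spread ratio», n = 8–12: min over affine
single foreign events E with |E| ≥ (1-η)2ⁿ, η ∈ {1/8, 1/4}, of |E ∩ Loss(P)|/|Loss(P)| for the
near-optimal affine/quadratic strategies of the M2/row-14R censuses) and the BC5 plan-only first
prover target (victim and foreign outputs of degree ≤ 1 via the AffBells37 slice-expansion fibre
method run inside one kernel-parity event). Record of the dial, not a binder. [difficulty: L] -/
@[route_item "route-QuantumAdvantage-SpreadDial"]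
def SpreadLossSingle3 : Prop :=
  ∃ η : ℝ, 0 < η ∧ ∃ k : ℕ, ∀ c : ℕ, ∃ n₀ : ℕ, ∀ n ≥ n₀, ∀ P : Fin n → Literature.Computability.MetaComplexity.Smolensky.CubeFn (ZMod 3) n, (∀ i, P i ∈ Literature.Computability.MetaComplexity.Smolensky.lowDeg (ZMod 3) n ((Nat.log 2 n) ^ c)) → ∀ m : ℕ, m ≤ 1 → ∀ w : Fin m → Fin n → Bool, ∀ Q : Fin m → Fin n → Literature.Computability.MetaComplexity.Smolensky.CubeFn (ZMod 3) n, (∀ t i, Q t i ∈ Literature.Computability.MetaComplexity.Smolensky.lowDeg (ZMod 3) n ((Nat.log 2 n) ^ c)) → (1 - η) * (2 : ℝ) ^ n ≤ ((Finset.univ.filter fun y : Fin n → Bool => ∀ t, Literature.Computability.QuantumComplexity.RingHLF.Rel (w t) (fun i => decide (Q t i y = 1))).card : ℝ) → 1 / (n : ℝ) ^ k * (2 : ℝ) ^ n ≤ ((Finset.univ.filter fun y : Fin n → Bool => (∀ t, Literature.Computability.QuantumComplexity.RingHLF.Rel (w t) (fun i => decide (Q t i y = 1))) ∧ ¬ Literature.Computability.QuantumComplexity.RingHLF.Rel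 y (fun i => decide (P i y = 1))).card : ℝ)

/-- item stmt-QuantumAdvantage-29068 · aside · rank 9 · open · by planner
sources: arXiv:1704.00690, goldreich2004
[support] aside — ORDER RECORDS of the node, all PROVED there (writer junction `spreadOrder3_holds`
:= ⟨dpLift3_of_coverLift3, polyLoss3_of_spreadLoss3, spreadLossSingle3_of_spreadLoss3,
spreadLoss3_of_ringHardOdd⟩; closable by one port): (CoverLift3 → DPLift3) ∧ (SpreadLoss3 →
PolyLoss3) ∧ (SpreadLoss3 → SpreadLossSingle3) ∧ (RingHardOdd 3 → SpreadLoss3). Kill lane: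
¬SpreadLoss3 ⇒ ¬RingHardOdd 3 (closes DWalkThree:22907 / DegreeDial:24213 negatively). [difficulty:
provable-now] -/
@[route_item "route-QuantumAdvantage-SpreadDial"]
def SpreadOrder3 : Prop :=
  (CoverLift3 → DPLift3) ∧ (SpreadLoss3 → PolyLoss3) ∧ (SpreadLoss3 → SpreadLossSingle3) ∧ (Summit.QuantumAdvantage.AdviceFreeQNC0.RingHardOdd 3 → SpreadLoss3)

/-- item stmt-QuantumAdvantage-30970 · aside · rank 9 · open · by planner
sources: arXiv:1704.00690, doi:10.1145/28395.28404, doi:10.1109/SFCS.1995.492584, arXiv:2408.16406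
[aside · RECORD of T**_alg (the children AlgCover3 / PureCover3 INLINE this text, so the in-cone
content is carried by them; filed aside under the NAMED-RUNG RULE because no binder references the
standalone decl — the gate renders split children next to the parent, ahead of any later item) ·
T**_alg, the NEW typed intermediate of the residual 29065 · WEAKER than SpreadLoss3 29064
(algSpread3_of_spreadLoss3 PROVED: ONE steered foreign ring 0·1^{n−1} realises any algebraic test, m
= 1) · STRONGER than PolyLoss3 26123 (ψ := 1) · UNDECIDED strictness both sides · ONE MODULUS ⇒
outside Literature.Barriers.QuantumAdvantage.TwoModuliDepthTwo] algebraic spread at poly-loss grade: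
∃ η > 0 ∃ k ∀ c, for all large n, every polylog-degree 𝔽₃ single-ring strategy P loses on ≥ 2^n/n^k
inputs INSIDE every DENSE (≥ (1−η)·2^n) 𝔽₃-ALGEBRAIC test {ψ = 1}, ψ of degree ≤ (log₂ n)^c —
Impagliazzo hard-core form (a) «hardness spread over every significant set» relativised to the
class's own definable sets. AXIS = definability class of the TEST: ∅ (26123) ⊂ one 𝔽₃ test (this) ⊂
≤ n^k two-moduli foreign-win tests (29064); order T = RingHardOdd 3 ⟹ SpreadLoss3 ⟹ AlgSpread3 ⟹
PolyLoss3 PROVED linear in the no -/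
@[route_item "route-QuantumAdvantage-SpreadDial"]
def AlgSpread3 : Prop :=
  ∃ η : ℝ, 0 < η ∧ ∃ k : ℕ, ∀ c : ℕ, ∃ n₀ : ℕ, ∀ n ≥ n₀, ∀ P : Fin n → Literature.Computability.MetaComplexity.Smolensky.CubeFn (ZMod 3) n, (∀ i, P i ∈ Literature.Computability.MetaComplexity.Smolensky.lowDeg (ZMod 3) n ((Nat.log 2 n) ^ c)) → ∀ ψ : Literature.Computability.MetaComplexity.Smolensky.CubeFn (ZMod 3) n, ψ ∈ Literature.Computability.MetaComplexity.Smolensky.lowDeg (ZMod 3) n ((Nat.log 2 n) ^ c) → (1 - η) * (2 : ℝ) ^ n ≤ ((Finset.univ.filter fun y : Fin n → Bool => ψ y = 1).card : ℝ) → 1 / (n : ℝ) ^ k * (2 : ℝ) ^ n ≤ ((Finset.univ.filter fun y : Fin n → Bool => ψ y = 1 ∧ ¬ Literature.Computability.QuantumComplexity.RingHLF.Rel y (fun i => decide (P i y = 1))).card : ℝ)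

/-- item stmt-QuantumAdvantage-30971 · aside · rank 9 · closed · proved by Summit.QuantumAdvantage.QuantumAdvantage.Theorems.SteerDial.levelCover3 (prover) · by planner
sources: arXiv:1704.00690, doi:10.1145/28395.28404, doi:10.1109/SFCS.1995.492584, arXiv:2408.16406
[aside · BC5 WITNESS of AlgCover3 (first rung of the test-family dial: the degree-2 algebraic tests
ψ = 1 − (lvl − t)², density ≈ 1/3) · PROVED in node: levelSpread3_of_polyLoss3 (k ↦ k+6, c ↦ 2c+1,
n₀ ↦ max n₀ 2^16 + 6; identity-word fold rel_fold + level splice, losses pull back injectively into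
level EXACTLY t) · sharpened to SINGLE level classes after critic row 40 · outside the cone of
closes ⇒ kind aside (NAMED-RUNG RULE); LAND (prover lane): Theorems/SteerDialLevel.lean = node
§Fold/§Indicator/§Words/§Level with `theorem levelCover3 : SpreadDial.LevelCover3 := fun hP =>
levelSpread3_of_polyLoss3 hP` (item text = node text with `lvl` inlined, closes by delta)] PolyLoss3
⇒ some k, every c, all large n, every polylog-degree P, every t : ZMod 3: ≥ 2^n/n^k losing inputs x
with Σ_i [x_i] ≡ t (mod 3). -/
@[route_item "route-QuantumAdvantage-SpreadDial"]
def LevelCover3 : Prop :=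
  PolyLoss3 → ∃ k : ℕ, ∀ c : ℕ, ∃ n₀ : ℕ, ∀ n ≥ n₀, ∀ P : Fin n → Literature.Computability.MetaComplexity.Smolensky.CubeFn (ZMod 3) n, (∀ i, P i ∈ Literature.Computability.MetaComplexity.Smolensky.lowDeg (ZMod 3) n ((Nat.log 2 n) ^ c)) → ∀ t : ZMod 3, 1 / (n : ℝ) ^ k * (2 : ℝ) ^ n ≤ ((Finset.univ.filter fun x : Fin n → Bool => (∑ i, (if x i then (1 : ZMod 3) else 0)) = t ∧ ¬ Literature.Computability.QuantumComplexity.RingHLF.Rel x (fun i => decide (P i x = 1))).card : ℝ)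

-- `LevelCover3` holds: proved by `Summit.QuantumAdvantage.QuantumAdvantage.Theorems.SteerDial.levelCover3` (its module imports this route file, so no `_holds` link can be stated here).

/-- item stmt-QuantumAdvantage-29069 · assembly · rank 1 · open · by planner
sources: arXiv:1704.00690, doi:10.1145/28395.28404
[assembly] PolyLoss3 → CoverLift3 → SpreadBridge3 → MultiRingBridge3 → the leaf AdviceFreeQNC0Three
(rung F-Q1-p3). -/
@[route_item "route-QuantumAdvantage-SpreadDial"]
def Assembly : Prop :=
  PolyLoss3 → CoverLift3 → SpreadBridge3 → MultiRingBridge3 → Summit.QuantumAdvantage.AdviceFreeQNC0.AdviceFreeQNC0Three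

/-! D-0027 §2.1 — DECIDING THEOREM (planner-authored via `route open/edit --closes-file`; by planner-decomp-qadv-writer-1-g3-0 2026-08-30T06:08:10Z):
its hypotheses are this route's items and its conclusion the registered leaf `Summit.QuantumAdvantage.AdviceFreeQNC0.AdviceFreeQNC0Three` (rung F-Q1-p3, D-0061) (glue_lint), and it elaborates with this file. -/

@[closes "route-QuantumAdvantage-SpreadDial"] theorem closes (hP : PolyLoss3) (hC : CoverLift3) (hH : SpreadBridge3) (hB : MultiRingBridge3) :
    Summit.QuantumAdvantage.AdviceFreeQNC0.AdviceFreeQNC0Three :=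
  Summit.QuantumAdvantage.AdviceFreeQNC0.adviceFreeQNC0Three_iff.mpr
    (Summit.QuantumAdvantage.QuantumAdvantage.Theorems.adviceFreeQNC0Sep_of_hlfNotFAC0Mod 3 (hB (hH (hC hP))))

end Summit.QuantumAdvantage.QuantumAdvantage.Theses.SpreadDial
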